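import Mathlib
import Summits.Ventures.PercRepro2.Defs
import Summits.Ventures.PercRepro2.Independence
import Summits.Ventures.PercRepro2.Harris
import Summits.Ventures.PercRepro2.FourFunctions
import Summits.Ventures.PercRepro2.BoxUnionDefs
import Summits.Ventures.PercRepro2.BoxUnionFKG
import Summits.Ventures.PercRepro2.BoxUnion
import Summits.Ventures.PercRepro2.BoxUnionPerc
import Summits.Ventures.PercRepro2.BoxUnionShapeWitness
import Summits.Ventures.PercRepro2.BoxUnionShape
import Summits.Ventures.PercRepro2.BoxUnionFaceWitness
import Summits.Ventures.PercRepro2.BoxUnionFaceTrace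
import Summits.Ventures.PercRepro2.BoxUnionCubeLemmas
import Summits.Ventures.PercRepro2.BoxUnionShapePercCore

/-!
# The shape theorem for bond percolation: box unions are exactly the events that keep the
Harris covariance nonnegative (blind cell PercRepro2, mine-1 g37; paper proof
proofs/MINE1-BOXUNION-SHAPE.md, part B)

For an event `U ⊆ Config E` of Bernoulli bond percolation on a finite edge set `E`, the following
are equivalent (`shape_perc_iff`, `shape_perc_events_iff`):

* for every admissible weight `p` (`IsProbVec p`) and all monotone `f g`, the restricted
  covariance `∑_{ω ∈ U} weight p ω (f ω − E f)(g ω − E g)` is nonnegative;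
* for every admissible `p` and all increasing events `A B`,
  `P(A) P(B ∩ U) + P(B) P(A ∩ U) ≤ P(A ∩ B ∩ U) + P(A) P(B) P(U)`;
* `U` is `∅`, `allClosed F` (every edge of `F` closed), `allOpen F'` (every edge of `F'` open), or
  `allClosed F ∪ allOpen F'` for some edge sets `F F'`.

Sufficiency is `boxUnion_perc_nonneg` (`BoxUnionPerc.lean`) and the single-box lemmas
`Iic_good` / `Ici_good` (`BoxUnionShape.lean`) with `ν = weight p`; necessity: a bad 2-face trace
of `U` is refuted by a product measure with `p = 1/2` on two coordinates and `p ∈ {0, 1}`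
elsewhere (`BoxUnionFaceTrace.lean`), and a set without bad 2-face traces is a box union
(`boxUnion_of_no_bad_face`, `BoxUnionShapePercCore.lean`).  Both classes of test measures — all
log-supermodular weights (`BoxUnion.good_iff`) and product measures only — single out the same
shapes.
-/

namespace Summit.Ventures.PercRepro2

open Finset BoxUnion

open scoped Classical

noncomputable section

section Translation

variable {E : Type*} [Fintype E] [DecidableEq E]

/-- A principal down-set of configurations is the event "all edges of `F` closed" for
`F = {e | a e = false}`. -/
lemma Iic_eq_allClosed (a : Config E) :
    Set.Iic a = allClosed (univ.filter fun e => a e = false) := by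
  ext ω
  rw [mem_allClosed_iff_le, Set.mem_Iic]
  have : (fun e => decide (e ∉ univ.filter fun e => a e = false)) = a := by
    funext e
    cases h : a e <;> simp [h]
  rw [this]

/-- A principal up-set of configurations is the event "all edges of `F'` open" for
`F' = {e | b e = true}`. -/
lemma Ici_eq_allOpen (b : Config E) :
    Set.Ici b = allOpen (univ.filter fun e => b e = true) := by
  ext ω
  rw [mem_allOpen_iff_le, Set.mem_Ici]
  have : (fun e => decide (e ∈ univ.filter fun e => b e = true)) = b := by
    funext e
    cases h : b e <;> simp [h]
  rw [this]

/-- The restricted covariance of two event indicators, expanded in probabilities. -/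
lemma cov_sum_indicator_eq (p : E → ℝ) (A B U : Set (Config E)) :
    (∑ ω, if ω ∈ U then
      weight p ω * ((A.indicator 1 ω - prob p A) * (B.indicator 1 ω - prob p B)) else 0) =
    prob p (A ∩ B ∩ U) + prob p A * prob p B * prob p U -
      (prob p A * prob p (B ∩ U) + prob p B * prob p (A ∩ U)) := by
  set PA := prob p A with hPA
  set PB := prob p B with hPB
  have expand : ∀ ω, (if ω ∈ U then
      weight p ω * ((A.indicator 1 ω - PA) * (B.indicator 1 ω - PB)) else 0) =
      (A ∩ B ∩ U).indicator (weight p) ω + PA * PB * U.indicator (weight p) ω -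
        (PA * (B ∩ U).indicator (weight p) ω + PB * (A ∩ U).indicator (weight p) ω) := by
    intro ω
    by_cases hUω : ω ∈ U
    · by_cases hAω : ω ∈ A
      · by_cases hBω : ω ∈ B
        · simp only [Set.indicator_apply, Set.mem_inter_iff, hUω, hAω, hBω, and_self, if_true,
            Pi.one_apply]
          ring
        · simp only [Set.indicator_apply, Set.mem_inter_iff, hUω, hAω, hBω, and_self, and_true,
            and_false, if_true, if_false, Pi.one_apply]
          ring
      · by_cases hBω : ω ∈ B
        · simp only [Set.indicator_apply, Set.mem_inter_iff, hUω, hAω, hBω, and_self, and_true,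
            if_true, if_false, Pi.one_apply]
          ring
        · simp only [Set.indicator_apply, Set.mem_inter_iff, hUω, hAω, hBω, and_self, and_true,
            if_true, if_false, Pi.one_apply]
          ring
    · simp only [Set.indicator_apply, Set.mem_inter_iff, hUω, and_false, if_false, mul_zero,
        add_zero, sub_zero]
  rw [Finset.sum_congr rfl (fun ω _ => expand ω), Finset.sum_sub_distrib,
    Finset.sum_add_distrib, Finset.sum_add_distrib, ← Finset.mul_sum, ← Finset.mul_sum,
    ← Finset.mul_sum]
  rfl

end Translation

section Sufficiency

variable {E : Type*} [Fintype E] [DecidableEq E]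

/-- The single down-box `allClosed F` keeps the restricted covariance nonnegative. -/
theorem cov_nonneg_allClosed {p : E → ℝ} (hp : IsProbVec p) (F : Finset E)
    {f g : Config E → ℝ} (hf : Monotone f) (hg : Monotone g) :
    0 ≤ ∑ ω, if ω ∈ allClosed F then
      weight p ω * ((f ω - expect p f) * (g ω - expect p g)) else 0 := by
  have key := Iic_good (fun e => decide (e ∉ F)) (weight_nonneg hp)
    (weight_mul_weight_le_weight_inf_mul_weight_sup p) (by rw [sum_weight]; exact one_pos) hf hg
  simp only [mean_weight_eq_expect] at key
  refine le_of_le_of_eq key (Finset.sum_congr rfl fun ω _ => ?_)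
  by_cases h : ω ∈ allClosed F
  · rw [if_pos (show ω ∈ Set.Iic (fun e => decide (e ∉ F)) from (mem_allClosed_iff_le F ω).mp h),
      if_pos h]
  · rw [if_neg (show ω ∉ Set.Iic (fun e => decide (e ∉ F)) from
      fun h' => h ((mem_allClosed_iff_le F ω).mpr h')), if_neg h]

/-- The single up-box `allOpen F'` keeps the restricted covariance nonnegative. -/
theorem cov_nonneg_allOpen {p : E → ℝ} (hp : IsProbVec p) (F' : Finset E)
    {f g : Config E → ℝ} (hf : Monotone f) (hg : Monotone g) :
    0 ≤ ∑ ω, if ω ∈ allOpen F' then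
      weight p ω * ((f ω - expect p f) * (g ω - expect p g)) else 0 := by
  have key := Ici_good (fun e => decide (e ∈ F')) (weight_nonneg hp)
    (weight_mul_weight_le_weight_inf_mul_weight_sup p) (by rw [sum_weight]; exact one_pos) hf hg
  simp only [mean_weight_eq_expect] at key
  refine le_of_le_of_eq key (Finset.sum_congr rfl fun ω _ => ?_)
  by_cases h : ω ∈ allOpen F'
  · rw [if_pos (show ω ∈ Set.Ici (fun e => decide (e ∈ F')) from (mem_allOpen_iff_le F' ω).mp h),
      if_pos h]
  · rw [if_neg (show ω ∉ Set.Ici (fun e => decide (e ∈ F')) from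
      fun h' => h ((mem_allOpen_iff_le F' ω).mpr h')), if_neg h]

end Sufficiency

section Necessity

variable {E : Type*} [Fintype E] [DecidableEq E]

omit [Fintype E] in
/-- The face weight `p i = p j = 1/2`, `p e = x e` elsewhere, as an explicit function. -/
lemma face_weight_spec (x : Config E) (i j : E) :
    (fun e => if e = i ∨ e = j then (1 / 2 : ℝ) else if x e then 1 else 0) i = 1 / 2 ∧
    (fun e => if e = i ∨ e = j then (1 / 2 : ℝ) else if x e then 1 else 0) j = 1 / 2 ∧
    ∀ e, e ≠ i → e ≠ j →
      (fun e => if e = i ∨ e = j then (1 / 2 : ℝ) else if x e then 1 else 0) e =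
        if x e then 1 else 0 := by
  refine ⟨by simp, by simp, fun e hei hej => by simp [hei, hej]⟩

/-- **Necessity, event form.** If the restricted Harris inequality holds for every admissible
weight and all increasing events, then `U` is `∅`, `allClosed F`, `allOpen F'` or
`allClosed F ∪ allOpen F'`. -/
theorem shape_perc_of_events (U : Set (Config E))
    (hU : ∀ p : E → ℝ, IsProbVec p → ∀ A B : Set (Config E), IsUpperSet A → IsUpperSet B →
      prob p A * prob p (B ∩ U) + prob p B * prob p (A ∩ U) ≤
        prob p (A ∩ B ∩ U) + prob p A * prob p B * prob p U) :
    U = ∅ ∨ (∃ F : Finset E, U = allClosed F) ∨ (∃ F' : Finset E, U = allOpen F') ∨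
      ∃ F F' : Finset E, U = allClosed F ∪ allOpen F' := by
  -- from the event inequality to the covariance sum of two principal up-set indicators
  have hcov : ∀ (p : E → ℝ), IsProbVec p → ∀ c c' : Config E,
      0 ≤ ∑ ω, if ω ∈ U then weight p ω *
        (((Set.Ici c).indicator 1 ω - expect p ((Set.Ici c).indicator 1)) *
          ((Set.Ici c').indicator 1 ω - expect p ((Set.Ici c').indicator 1))) else 0 := by
    intro p hp c c'
    have h := hU p hp (Set.Ici c) (Set.Ici c') (isUpperSet_Ici c) (isUpperSet_Ici c')
    rw [← prob_eq_expect_indicator, ← prob_eq_expect_indicator, cov_sum_indicator_eq]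
    linarith
  have T1 : ∀ (x : Config E) (i j : E), i ≠ j → x i = false → x j = false → x ∉ U →
      Function.update x i true ∈ U → Function.update x j true ∉ U →
      Function.update (Function.update x i true) j true ∉ U → False := by
    intro x i j hij hxi hxj h0 h1 h2 h3
    obtain ⟨hpi, hpj, hpe⟩ := face_weight_spec x i j
    linarith [hcov _ (isProbVec_face hpi hpj hpe) (Function.update (Function.update x i true) j true)
      (Function.update x i true), face_trace_d_cov hij hxi hxj hpi hpj hpe h0 h1 h2 h3]
  have T3 : ∀ (x : Config E) (i j : E), i ≠ j → x i = false → x j = false → x ∉ U →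
      Function.update x i true ∈ U → Function.update x j true ∈ U →
      Function.update (Function.update x i true) j true ∉ U → False := by
    intro x i j hij hxi hxj h0 h1 h2 h3
    obtain ⟨hpi, hpj, hpe⟩ := face_weight_spec x i j
    linarith [hcov _ (isProbVec_face hpi hpj hpe) (Function.update x i true)
      (Function.update x j true), face_trace_dd'_cov hij hxi hxj hpi hpj hpe h0 h1 h2 h3]
  have T4 : ∀ (x : Config E) (i j : E), i ≠ j → x i = false → x j = false → x ∈ U →
      Function.update x i true ∈ U → Function.update x j true ∈ U →
      Function.update (Function.update x i true) j true ∉ U → False := by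
    intro x i j hij hxi hxj h0 h1 h2 h3
    obtain ⟨hpi, hpj, hpe⟩ := face_weight_spec x i j
    linarith [hcov _ (isProbVec_face hpi hpj hpe) (Function.update x i true)
      (Function.update x j true), face_trace_top_cov hij hxi hxj hpi hpj hpe h0 h1 h2 h3]
  have T5 : ∀ (x : Config E) (i j : E), i ≠ j → x i = false → x j = false → x ∉ U →
      Function.update x i true ∈ U → Function.update x j true ∈ U →
      Function.update (Function.update x i true) j true ∈ U → False := by
    intro x i j hij hxi hxj h0 h1 h2 h3
    obtain ⟨hpi, hpj, hpe⟩ := face_weight_spec x i j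
    linarith [hcov _ (isProbVec_face hpi hpj hpe) (Function.update x i true)
      (Function.update x j true), face_trace_bot_cov hij hxi hxj hpi hpj hpe h0 h1 h2 h3]
  rcases boxUnion_of_no_bad_face U T1 T3 T4 T5 with h | ⟨a, ha⟩ | ⟨b, hb⟩ | ⟨a, b, hab⟩
  · exact Or.inl h
  · exact Or.inr (Or.inl ⟨_, by rw [ha, Iic_eq_allClosed]⟩)
  · exact Or.inr (Or.inr (Or.inl ⟨_, by rw [hb, Ici_eq_allOpen]⟩))
  · refine Or.inr (Or.inr (Or.inr ⟨univ.filter fun e => a e = false,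
      univ.filter fun e => b e = true, ?_⟩))
    rw [hab, ← Iic_eq_allClosed, ← Ici_eq_allOpen]
    ext x
    simp only [mem_boxUnion, Set.mem_union, Set.mem_Iic, Set.mem_Ici]

/-- **Necessity, covariance form.** -/
theorem shape_perc_of_cov (U : Set (Config E))
    (hU : ∀ p : E → ℝ, IsProbVec p → ∀ f g : Config E → ℝ, Monotone f → Monotone g →
      0 ≤ ∑ ω, if ω ∈ U then weight p ω * ((f ω - expect p f) * (g ω - expect p g)) else 0) :
    U = ∅ ∨ (∃ F : Finset E, U = allClosed F) ∨ (∃ F' : Finset E, U = allOpen F') ∨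
      ∃ F F' : Finset E, U = allClosed F ∪ allOpen F' := by
  refine shape_perc_of_events U fun p hp A B hA hB => ?_
  have h := hU p hp _ _ (monotone_indicator_of_isUpperSet (R := ℝ) hA)
    (monotone_indicator_of_isUpperSet (R := ℝ) hB)
  rw [← prob_eq_expect_indicator, ← prob_eq_expect_indicator, cov_sum_indicator_eq] at h
  linarith

end Necessity

section Main

variable {E : Type*} [Fintype E] [DecidableEq E]

/-- **The shape theorem for bond percolation, covariance form.** The restricted covariance
`∑_{ω ∈ U} weight p ω (f ω − E f)(g ω − E g)` is nonnegative for every admissible weight `p` and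
all monotone `f g` IF AND ONLY IF `U` is `∅`, `allClosed F`, `allOpen F'` or
`allClosed F ∪ allOpen F'`. -/
theorem shape_perc_iff (U : Set (Config E)) :
    (∀ p : E → ℝ, IsProbVec p → ∀ f g : Config E → ℝ, Monotone f → Monotone g →
      0 ≤ ∑ ω, if ω ∈ U then weight p ω * ((f ω - expect p f) * (g ω - expect p g)) else 0) ↔
    (U = ∅ ∨ (∃ F : Finset E, U = allClosed F) ∨ (∃ F' : Finset E, U = allOpen F') ∨
      ∃ F F' : Finset E, U = allClosed F ∪ allOpen F') := by
  constructor
  · exact shape_perc_of_cov U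
  · rintro (rfl | ⟨F, rfl⟩ | ⟨F', rfl⟩ | ⟨F, F', rfl⟩) p hp f g hf hg
    · simp
    · exact cov_nonneg_allClosed hp F hf hg
    · exact cov_nonneg_allOpen hp F' hf hg
    · refine le_of_le_of_eq (boxUnion_perc_nonneg hp F F' hf hg)
        (Finset.sum_congr rfl fun ω _ => ?_)
      by_cases h : ω ∈ allClosed F ∪ allOpen F'
      · rw [if_pos h, if_pos h]
      · rw [if_neg h, if_neg h]

/-- **The shape theorem for bond percolation, event form.** The restricted Harris inequality
`P(A) P(B ∩ U) + P(B) P(A ∩ U) ≤ P(A ∩ B ∩ U) + P(A) P(B) P(U)` holds for every admissible weight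
and all increasing events `A B` IF AND ONLY IF `U` is `∅`, `allClosed F`, `allOpen F'` or
`allClosed F ∪ allOpen F'`. -/
theorem shape_perc_events_iff (U : Set (Config E)) :
    (∀ p : E → ℝ, IsProbVec p → ∀ A B : Set (Config E), IsUpperSet A → IsUpperSet B →
      prob p A * prob p (B ∩ U) + prob p B * prob p (A ∩ U) ≤
        prob p (A ∩ B ∩ U) + prob p A * prob p B * prob p U) ↔
    (U = ∅ ∨ (∃ F : Finset E, U = allClosed F) ∨ (∃ F' : Finset E, U = allOpen F') ∨
      ∃ F F' : Finset E, U = allClosed F ∪ allOpen F') := by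
  constructor
  · exact shape_perc_of_events U
  · intro hbox p hp A B hA hB
    have h := (shape_perc_iff U).mpr hbox p hp _ _ (monotone_indicator_of_isUpperSet (R := ℝ) hA)
      (monotone_indicator_of_isUpperSet (R := ℝ) hB)
    rw [← prob_eq_expect_indicator, ← prob_eq_expect_indicator, cov_sum_indicator_eq] at h
    linarith

end Main

end

end Summit.Ventures.PercRepro2
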